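import Mathlib.Algebra.MonoidAlgebra.Basic
import Mathlib.RingTheory.Adjoin.Basic
import Mathlib.RingTheory.Spectrum.Prime.Basic
import Mathlib.Tactic.LinearCombination
import HarnessLib

/-!
# Toric surface programme: the torus-fixed point is the only point of `U(r,a)` outside `D(x) ∪ D(w)`

Support file for crux stmt-ResolutionOfSingularities-15317 (`FrobeniusLadder.FRationalResolution`),
line `redirect`, lead c4 (toric surface programme for rung 4′: all affine toric surfaces
`U(r,a) = Spec k[{m ∈ ℤ² : 0 ≤ m₂, a m₂ ≤ r m₁}]` over every field are resolved by the
Hirzebruch–Jung tower, with resolutions that are isomorphisms over `D(x) ∪ D(w)`; this file shows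
that open IS the complement of a single point, the vertex). Stub `stub_toric_point_eq`.

Let `R = TA[r,a] = k[σ∨ ∩ ℤ²] ⊆ k[ℤ²]` (`1 ≤ r`) with `x = χ^(1,0)`, `w = χ^(a,r)` the monomials
of the two facets of `σ∨ = cone((1,0),(a,r))`.

* `toricVertex_single_mem` — a prime `P ∋ x, w` contains every non-constant cone monomial `χ^m`:
  `r • m = (r m₁ - a m₂) • (1,0) + m₂ • (a,r)` with natural coefficients not both zero, so
  `(χ^m)^r = x^i w^j ∈ P`;
* `toricVertex_mem_span` — `R` is the `k`-span of the cone monomials (they form a multiplicative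
  set containing `1`, `Algebra.adjoin_eq_span_of_subset`);
* `toricVertex_sub_const_mem` — hence `t - t(0) ∈ P` for every `t ∈ R` (`t(0)` the constant
  coefficient), by `Submodule.span_induction`;
* `toricVertex_mem_iff` — so `t ∈ P ↔ t(0) = 0` (a nonzero constant is a unit);
* `stub_toric_point_eq` — two primes containing `x` and `w` coincide.

All folklore (Fulton 1993 §2.1, §3.1: the distinguished point `x_σ` of a full-dimensional cone;
Cox–Little–Schenck 2011, Cor. 1.3.9 ff.); only Mathlib's `AddMonoidAlgebra` / `Algebra.adjoin` /
`Ideal` API is used; no named facts.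
-/

set_option linter.dupNamespace false

noncomputable section

namespace Summit.ResolutionOfSingularities.ResolutionOfSingularities.Theorems.FRationalResolution

section Toric

variable (k : Type) [Field k]

/-- The Laurent polynomial ring `k[ℤ²]` (coordinate ring of the 2-torus). -/
local notation3 "Lk" => AddMonoidAlgebra k (ℤ × ℤ)

/-- The lattice points of the dual cone `σ∨ = {m₂ ≥ 0, a m₂ ≤ r m₁}` of `σ = cone((0,1),(r,-a))`. -/
local notation3 "σS[" r ", " a "]" =>
  {m : ℤ × ℤ | 0 ≤ m.2 ∧ ((a : ℕ) : ℤ) * m.2 ≤ ((r : ℕ) : ℤ) * m.1}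

/-- The toric surface algebra `k[σ∨ ∩ ℤ²] ⊆ k[ℤ²]`. -/
local notation3 "TA[" r ", " a "]" =>
  Algebra.adjoin k ((fun m : ℤ × ℤ => AddMonoidAlgebra.single m (1 : k)) '' σS[r, a])

/-- **Non-constant cone monomials lie in every prime through the vertex.** For `1 ≤ r`, a prime
ideal `P` of `TA[r,a]` containing `x = χ^(1,0)` and `w = χ^(a,r)` contains `χ^m` for every
lattice point `m ≠ 0` of `σ∨`: with `i = r m₁ - a m₂ ≥ 0`, `j = m₂ ≥ 0` one has
`r • m = i • (1,0) + j • (a,r)`, so `(χ^m)^r = x^i · w^j`; here `i = j = 0` would force `m = 0`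
(as `r ≥ 1`), so `x^i w^j ∈ P` and `χ^m ∈ P` by primality. [folklore; Fulton 1993 §3.1] -/
theorem toricVertex_single_mem (r a : ℕ) (hr : 1 ≤ r) (x w : ↥TA[r, a])
    (hx : (x : Lk) = AddMonoidAlgebra.single ((1 : ℤ), (0 : ℤ)) 1)
    (hw : (w : Lk) = AddMonoidAlgebra.single ((a : ℤ), (r : ℤ)) 1)
    (P : Ideal ↥TA[r, a]) [hP : P.IsPrime] (hxP : x ∈ P) (hwP : w ∈ P)
    (m : ℤ × ℤ) (hm : m ∈ σS[r, a]) (hm0 : m ≠ 0)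
    (h : AddMonoidAlgebra.single m (1 : k) ∈ TA[r, a]) :
    (⟨AddMonoidAlgebra.single m (1 : k), h⟩ : ↥TA[r, a]) ∈ P := by
  obtain ⟨hm2, hmc⟩ := hm
  -- natural exponents `j = m₂`, `i = r m₁ - a m₂`
  obtain ⟨j, hj⟩ := Int.eq_ofNat_of_zero_le hm2
  obtain ⟨i, hi⟩ := Int.eq_ofNat_of_zero_le (sub_nonneg.mpr hmc)
  -- `(χ^m)^r = x^i · w^j`
  have hpow : (⟨AddMonoidAlgebra.single m (1 : k), h⟩ : ↥TA[r, a]) ^ r = x ^ i * w ^ j := by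
    apply Subtype.ext
    simp only [Subalgebra.coe_pow, Subalgebra.coe_mul, hx, hw, AddMonoidAlgebra.single_pow,
      AddMonoidAlgebra.single_mul_single, one_pow, mul_one]
    congr 1
    refine Prod.ext ?_ ?_
    · simp only [Prod.smul_fst, Prod.fst_add]
      simp only [nsmul_eq_mul, mul_one]
      linear_combination hi + (a : ℤ) * hj
    · simp only [Prod.smul_snd, Prod.snd_add]
      simp only [nsmul_eq_mul, mul_zero, zero_add]
      linear_combination (r : ℤ) * hj
  refine hP.mem_of_pow_mem r ?_
  rw [hpow]
  rcases Nat.eq_zero_or_pos j with rfl | hjpos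
  · -- `m₂ = 0`: then `i = r m₁ > 0`, for otherwise `m = 0`
    have hipos : 0 < i := by
      refine Nat.pos_of_ne_zero fun hi0 => hm0 ?_
      subst hi0
      have h2 : m.2 = 0 := by simpa using hj
      have hr0 : (r : ℤ) ≠ 0 := by exact_mod_cast Nat.one_le_iff_ne_zero.mp hr
      have h1 : (r : ℤ) * m.1 = 0 := by
        rw [h2, mul_zero, sub_zero, Nat.cast_zero] at hi
        exact hi
      exact Prod.ext ((mul_eq_zero.mp h1).resolve_left hr0) h2
    exact Ideal.mul_mem_right _ _ (Ideal.pow_mem_of_mem P hxP i hipos)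
  · exact Ideal.mul_mem_left _ _ (Ideal.pow_mem_of_mem P hwP j hjpos)

/-- **`TA[r,a]` is the `k`-span of the cone monomials.** The monomials `χ^m`, `m ∈ σ∨ ∩ ℤ²`, form
a multiplicative subset of `k[ℤ²]` containing `1 = χ^0` (`σ∨ ∩ ℤ²` is a monoid), so the
subalgebra they generate is their `k`-linear span (`Algebra.adjoin_eq_span_of_subset`).
[folklore; CLS2011 §1.1] -/
theorem toricVertex_mem_span (r a : ℕ) (t : Lk) (ht : t ∈ TA[r, a]) :
    t ∈ Submodule.span k ((fun m : ℤ × ℤ => AddMonoidAlgebra.single m (1 : k)) '' σS[r, a]) := by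
  have key : (↑(Submonoid.closure
      ((fun m : ℤ × ℤ => AddMonoidAlgebra.single m (1 : k)) '' σS[r, a])) : Set Lk) ⊆
      (fun m : ℤ × ℤ => AddMonoidAlgebra.single m (1 : k)) '' σS[r, a] := by
    intro u hu
    induction hu using Submonoid.closure_induction with
    | mem u hu => exact hu
    | one => exact ⟨0, by simp, AddMonoidAlgebra.one_def.symm⟩
    | mul u v _ _ ihu ihv =>
      obtain ⟨m, hm, rfl⟩ := ihu
      obtain ⟨n, hn, rfl⟩ := ihv
      refine ⟨m + n, ⟨?_, ?_⟩, ?_⟩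
      · simp only [Prod.snd_add]
        exact add_nonneg hm.1 hn.1
      · simp only [Prod.fst_add, Prod.snd_add, mul_add]
        exact add_le_add hm.2 hn.2
      · simp only [AddMonoidAlgebra.single_mul_single, mul_one]
  exact (Algebra.adjoin_eq_span_of_subset k (key.trans Submodule.subset_span)).le ht

/-- **Every element of `TA[r,a]` is its constant term modulo a prime through the vertex.** For
`1 ≤ r` and a prime `P` of `TA[r,a]` containing `x = χ^(1,0)`, `w = χ^(a,r)`, every `t ∈ TA[r,a]`
satisfies `t - t(0) ∈ P`, where `t(0)` is the constant coefficient: `t` is a `k`-combination of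
cone monomials (`toricVertex_mem_span`), the non-constant ones lie in `P`
(`toricVertex_single_mem`) and `χ^0 = 1` is its own constant term. [folklore] -/
theorem toricVertex_sub_const_mem (r a : ℕ) (hr : 1 ≤ r) (x w : ↥TA[r, a])
    (hx : (x : Lk) = AddMonoidAlgebra.single ((1 : ℤ), (0 : ℤ)) 1)
    (hw : (w : Lk) = AddMonoidAlgebra.single ((a : ℤ), (r : ℤ)) 1)
    (P : Ideal ↥TA[r, a]) [P.IsPrime] (hxP : x ∈ P) (hwP : w ∈ P) (t : ↥TA[r, a]) :
    t - algebraMap k ↥TA[r, a] ((t : Lk).coeff 0) ∈ P := by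
  obtain ⟨t, ht⟩ := t
  have hts := toricVertex_mem_span k r a t ht
  refine Submodule.span_induction
    (p := fun u _ => ∀ hu : u ∈ TA[r, a],
      (⟨u, hu⟩ : ↥TA[r, a]) - algebraMap k ↥TA[r, a] (u.coeff 0) ∈ P) ?_ ?_ ?_ ?_ hts ht
  · -- cone monomials
    rintro _ ⟨m, hm, rfl⟩ hu
    dsimp only
    by_cases hm0 : m = 0
    · subst hm0
      have h1 : (⟨AddMonoidAlgebra.single (0 : ℤ × ℤ) (1 : k), hu⟩ : ↥TA[r, a]) = 1 :=
        Subtype.ext rfl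
      rw [h1, AddMonoidAlgebra.coeff_single, Finsupp.single_eq_same, map_one, sub_self]
      exact P.zero_mem
    · rw [AddMonoidAlgebra.coeff_single, Finsupp.single_eq_of_ne' hm0, map_zero, sub_zero]
      exact toricVertex_single_mem k r a hr x w hx hw P hxP hwP m hm hm0 hu
  · -- zero
    intro hu
    have h0 : (⟨0, hu⟩ : ↥TA[r, a]) = 0 := Subtype.ext rfl
    rw [h0]
    simp
  · -- sums
    intro u v hu' hv' ihu ihv huv
    have hu : u ∈ TA[r, a] := Algebra.span_le_adjoin k _ hu'
    have hv : v ∈ TA[r, a] := Algebra.span_le_adjoin k _ hv'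
    have he : (⟨u + v, huv⟩ : ↥TA[r, a]) = ⟨u, hu⟩ + ⟨v, hv⟩ := rfl
    rw [he, AddMonoidAlgebra.coeff_add, Finsupp.add_apply, map_add, add_sub_add_comm]
    exact P.add_mem (ihu hu) (ihv hv)
  · -- scalar multiples
    intro c u hu' ihu hcu
    have hu : u ∈ TA[r, a] := Algebra.span_le_adjoin k _ hu'
    have he : (⟨c • u, hcu⟩ : ↥TA[r, a]) = c • ⟨u, hu⟩ := rfl
    rw [he, AddMonoidAlgebra.coeff_smul, Finsupp.smul_apply, smul_eq_mul, map_mul,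
      Algebra.smul_def, ← mul_sub]
    exact Ideal.mul_mem_left P _ (ihu hu)

/-- **Primes through the vertex are determined.** For `1 ≤ r` and a prime `P` of `TA[r,a]`
containing `x = χ^(1,0)` and `w = χ^(a,r)`: `t ∈ P ↔ t(0) = 0` (`t(0)` the constant
coefficient). `⇐`: `toricVertex_sub_const_mem`; `⇒`: otherwise the unit `t(0) = t - (t - t(0))`
lies in `P`. [folklore; Fulton 1993 §3.1] -/
theorem toricVertex_mem_iff (r a : ℕ) (hr : 1 ≤ r) (x w : ↥TA[r, a])
    (hx : (x : Lk) = AddMonoidAlgebra.single ((1 : ℤ), (0 : ℤ)) 1)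
    (hw : (w : Lk) = AddMonoidAlgebra.single ((a : ℤ), (r : ℤ)) 1)
    (P : Ideal ↥TA[r, a]) [hP : P.IsPrime] (hxP : x ∈ P) (hwP : w ∈ P) (t : ↥TA[r, a]) :
    t ∈ P ↔ (t : Lk).coeff 0 = 0 := by
  have h := toricVertex_sub_const_mem k r a hr x w hx hw P hxP hwP t
  refine ⟨fun ht => ?_, fun hc => by rwa [hc, map_zero, sub_zero] at h⟩
  by_contra hc
  refine hP.ne_top (Ideal.eq_top_of_isUnit_mem P ?_ ((IsUnit.mk0 _ hc).map (algebraMap k ↥TA[r, a])))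
  have h' := P.sub_mem ht h
  rwa [sub_sub_cancel] at h'

/-- **THE VERTEX IS THE ONLY POINT OF `U(r,a)` WITH `x = w = 0`** (registered stub
`stub_toric_point_eq`, crux stmt-ResolutionOfSingularities-15317, line `redirect`). For the toric
surface algebra `TA[r,a] = k[σ∨ ∩ ℤ²]`, `1 ≤ r`, with facet monomials `x = χ^(1,0)`, `w = χ^(a,r)`,
two primes `P, Q` of `TA[r,a]` both containing `x` and `w` are equal: each is the set of elements
with vanishing constant coefficient (`toricVertex_mem_iff`), i.e. the torus-fixed maximal ideal
spanned by all non-constant cone monomials. [folklore; Fulton 1993 §3.1] -/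
theorem stub_toric_point_eq (r a : ℕ) (hr : 1 ≤ r) (x w : ↥TA[r, a])
    (hx : (x : Lk) = AddMonoidAlgebra.single ((1 : ℤ), (0 : ℤ)) 1)
    (hw : (w : Lk) = AddMonoidAlgebra.single ((a : ℤ), (r : ℤ)) 1)
    (P Q : PrimeSpectrum ↥TA[r, a]) (hP : x ∈ P.asIdeal ∧ w ∈ P.asIdeal)
    (hQ : x ∈ Q.asIdeal ∧ w ∈ Q.asIdeal) : P = Q := by
  ext t
  rw [toricVertex_mem_iff k r a hr x w hx hw P.asIdeal hP.1 hP.2 t,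
    toricVertex_mem_iff k r a hr x w hx hw Q.asIdeal hQ.1 hQ.2 t]

end Toric

end Summit.ResolutionOfSingularities.ResolutionOfSingularities.Theorems.FRationalResolution

end
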